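import Summits.Ventures.HSemireg.WedgeHankelRecurrenceGaussOffDiagonalBound

/-!
# Venture HSemireg — **MARKOV'S THEOREM WITH A NON-NEGATIVE DENSITY, AND THE GAUSS NODES OF A TRUNCATED MEASURE**: N320 is extended to densities `g ≥ 0` that are positive on at least `t + 1`
# atoms (so that `gν` still has a `(t+1)`-point Gauss rule): non-decreasing `g` ⇒ `x_k ≤ y_k`, non-increasing `g` ⇒ `y_k ≤ x_k`; in particular RESTRICTING the measure to the atoms `w_l ≤ c`
# moves every Gauss node to the left, and restricting to `w_l ≥ c` moves every node to the right

HONEST FRAMING. Part of the Lean index of the computation cell `pub-hsemireg` (seat p10 gen 44, Sunday typer «UNIFORM-IN-n»).  Finite sums and real polynomials only; no variety, no cohomology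
theory, no sheaf, no Ext group and no semiregularity map is constructed here; nothing here says that HC / HC_CM / HC_AV holds; no Literature fact (unproved `Prop`) is declared or used.  Custodian
versions as in `WedgeHankelSiegelIdeal` (1/3).
SOURCES (cited).  A. Markov, Math. Ann. 27 (1886) 177–182; G. Szegő, *Orthogonal Polynomials*, Thm 6.12.1 ∕ 6.12.2 and §6.21; M. E. H. Ismail, *Classical and Quantum Orthogonal Polynomials* (2005)
§7.1; for truncation cf. the Cauchy interlacing ∕ Golub–Welsch picture (G. H. Golub, J. H. Welsch, Math. Comp. 23 (1969) 221–230).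
PROOF TYPED HERE.  As N320: the test polynomial `T_k` (N320 `markov_testPoly_spec`), the one-sided Rayleigh bounds at both rules (N320), the weighted Chebyshev inequality in both directions (N319);
positivity of `Σ gν T_k²` from `t + 1` charged atoms (a non-zero polynomial of degree `t` cannot vanish at `t + 1` distinct nodes).
DEDUP DISCLOSURE (`rg -n 'markov_monotone|truncat|restrict' Summits/Ventures/HSemireg`, 2026-09-03): N320 ∕ N321 require `g > 0` everywhere (N321's antitone form inverts `g`); the non-negative form
and the truncation corollaries are new.  The 5 names below: 0 hits tree-wide.

WHAT IS IN THE TREE.  N320 `markov_testPoly_spec`, `gaussNode_mul_sum_sq_le_of_eval_eq_zero_below`, `sum_node_sq_le_gaussNode_mul_of_eval_eq_zero_above`; N319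
`rayleigh_num_mul_le_of_monotone_density`, `rayleigh_num_mul_ge_of_antitone_density`; N265 `gauss_weight_nonneg`; N273 `sum_mul_eval_sq_pos_of_natDegree_lt`.
THIS FILE (namespace `Summit.Ventures.HSemireg.Wedge.HankelOuter` continued; CHAINED on N344 (import only); 0 definitions):
* §1110 `sum_density_mul_sq_pos_of_card` (`Σ gν P² > 0` for `P ≠ 0`, `deg P ≤ t`, when `g > 0` on `t + 1` atoms), **`markov_monotone_nonneg`** (`g ≥ 0` non-decreasing ⇒ `x_k ≤ y_k`),
  **`markov_antitone_nonneg`** (`g ≥ 0` non-increasing ⇒ `y_k ≤ x_k`), **`gauss_nodes_restrict_le`** (restriction to `{w ≤ c}` ⇒ `y_k ≤ x_k`), **`gauss_nodes_restrict_ge`** (restriction to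
  `{c ≤ w}` ⇒ `x_k ≤ y_k`).
CAVEATS.  Discrete positive measures; the restricted measure must keep at least `t + 1` atoms (hypothesis by a finset of charged indices).  Nothing Ext-side.  New names only.
-/

open Module Polynomial
open scoped Matrix Polynomial

namespace Summit.Ventures.HSemireg.Wedge.HankelOuter

/-! ## §1110. Markov's theorem for non-negative densities; truncated measures -/

/-- **`Σ_l g_l ν_l P(w_l)² > 0`** for `P ≠ 0` of degree `≤ t` when `ν > 0`, `g ≥ 0`, the nodes are distinct and `g > 0` on at least `t + 1` of them. [this file, §1110] -/
theorem sum_density_mul_sq_pos_of_card {t N : ℕ} {ν w g : Fin N → ℝ} (hν : ∀ l, 0 < ν l) (hw : Function.Injective w) (hg : ∀ l, 0 ≤ g l)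
    {S : Finset (Fin N)} (hS : t + 1 ≤ S.card) (hgS : ∀ l ∈ S, 0 < g l) {P : ℝ[X]} (hP : P ≠ 0) (hPd : P.natDegree ≤ t) :
    0 < ∑ l, (g l * ν l) * (P.eval (w l)) ^ 2 := by
  classical
  -- some charged node is not a root of `P`
  have hex : ∃ l ∈ S, P.eval (w l) ≠ 0 := by
    by_contra hall
    push Not at hall
    have h1 : (S.image w).card = S.card := Finset.card_image_of_injective _ hw
    have h2 : S.image w ⊆ P.roots.toFinset := by
      intro r hr
      obtain ⟨l, hl, rfl⟩ := Finset.mem_image.1 hr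
      rw [Multiset.mem_toFinset, mem_roots hP, IsRoot.def]
      exact hall l hl
    have h3 := (Finset.card_le_card h2).trans ((Multiset.toFinset_card_le _).trans ((card_roots' P).trans hPd))
    omega
  obtain ⟨l₀, hl₀, hP0⟩ := hex
  exact lt_of_lt_of_le (mul_pos (mul_pos (hgS l₀ hl₀) (hν l₀)) (sq_pos_iff.2 hP0))
    (Finset.single_le_sum (f := fun l => (g l * ν l) * (P.eval (w l)) ^ 2) (fun l _ => mul_nonneg (mul_nonneg (hg l) (hν l).le) (sq_nonneg _)) (Finset.mem_univ l₀))

/-- **MARKOV'S THEOREM FOR A NON-NEGATIVE NON-DECREASING DENSITY: `x_k ≤ y_k`** (Gauss rules `(μ, x)` of `ν` and `(μ', y)` of `gν`; `g ≥ 0` non-decreasing along the nodes, positive on `≥ t+1`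
atoms). [Markov 1886; Szegő Thm 6.12.1; this file, §1110] -/
theorem markov_monotone_nonneg {t N : ℕ} {ν w g : Fin N → ℝ} (hν : ∀ l, 0 < ν l) (hw : Function.Injective w) (hN : t + 1 ≤ N)
    (hg : ∀ l, 0 ≤ g l) (hgw : ∀ l l', w l < w l' → g l ≤ g l') {S : Finset (Fin N)} (hS : t + 1 ≤ S.card) (hgS : ∀ l ∈ S, 0 < g l)
    {μ x μ' y : Fin (t + 1) → ℝ} (hx : StrictMono x) (hy : StrictMono y)
    (hmom : ∀ p, p ≤ 2 * t + 1 → ∑ j, μ j * x j ^ p = ∑ l, ν l * w l ^ p)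
    (hmom' : ∀ p, p ≤ 2 * t + 1 → ∑ j, μ' j * y j ^ p = ∑ l, (g l * ν l) * w l ^ p) (k : Fin (t + 1)) :
    x k ≤ y k := by
  obtain ⟨hTm, hTd, hTx, hTy⟩ := markov_testPoly_spec x y k
  set T := ∏ j ∈ Finset.univ.erase k, (Polynomial.X - C (if j < k then x j else y j)) with hT
  have hμ : ∀ j, 0 ≤ μ j := gauss_weight_nonneg hx.injective (fun l => (hν l).le) (fun p hp => hmom p (by omega))
  have hμ' : ∀ j, 0 ≤ μ' j := gauss_weight_nonneg hy.injective (fun l => mul_nonneg (hg l) (hν l).le) (fun p hp => hmom' p (by omega))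
  have hA : 0 < ∑ l, ν l * (T.eval (w l)) ^ 2 := sum_mul_eval_sq_pos_of_natDegree_lt hν hw hTm.ne_zero (by omega)
  have hA' : 0 < ∑ l, (g l * ν l) * (T.eval (w l)) ^ 2 := sum_density_mul_sq_pos_of_card hν hw hg hS hgS hTm.ne_zero hTd.le
  have h1 := gaussNode_mul_sum_sq_le_of_eval_eq_zero_below hx hμ hmom hTd.le k hTx
  have h2 := sum_node_sq_le_gaussNode_mul_of_eval_eq_zero_above hy hμ' hmom' hTd.le k hTy
  have h3 := rayleigh_num_mul_le_of_monotone_density (fun l => (hν l).le) hgw T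
  set A := ∑ l, ν l * (T.eval (w l)) ^ 2
  set B := ∑ l, ν l * (w l * (T.eval (w l)) ^ 2)
  set A' := ∑ l, (g l * ν l) * (T.eval (w l)) ^ 2
  set B' := ∑ l, (g l * ν l) * (w l * (T.eval (w l)) ^ 2)
  refine le_of_mul_le_mul_right ?_ (mul_pos hA hA')
  calc x k * (A * A') = (x k * A) * A' := by ring
    _ ≤ B * A' := mul_le_mul_of_nonneg_right h1 hA'.le
    _ = A' * B := mul_comm _ _
    _ ≤ A * B' := h3
    _ ≤ A * (y k * A') := mul_le_mul_of_nonneg_left h2 hA.le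
    _ = y k * (A * A') := by ring

/-- **NON-NEGATIVE NON-INCREASING DENSITY: `y_k ≤ x_k`.** [Szegő Thm 6.12.1; this file, §1110] -/
theorem markov_antitone_nonneg {t N : ℕ} {ν w g : Fin N → ℝ} (hν : ∀ l, 0 < ν l) (hw : Function.Injective w) (hN : t + 1 ≤ N)
    (hg : ∀ l, 0 ≤ g l) (hgw : ∀ l l', w l < w l' → g l' ≤ g l) {S : Finset (Fin N)} (hS : t + 1 ≤ S.card) (hgS : ∀ l ∈ S, 0 < g l)
    {μ x μ' y : Fin (t + 1) → ℝ} (hx : StrictMono x) (hy : StrictMono y)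
    (hmom : ∀ p, p ≤ 2 * t + 1 → ∑ j, μ j * x j ^ p = ∑ l, ν l * w l ^ p)
    (hmom' : ∀ p, p ≤ 2 * t + 1 → ∑ j, μ' j * y j ^ p = ∑ l, (g l * ν l) * w l ^ p) (k : Fin (t + 1)) :
    y k ≤ x k := by
  obtain ⟨hTm, hTd, hTy, hTx⟩ := markov_testPoly_spec y x k
  set T := ∏ j ∈ Finset.univ.erase k, (Polynomial.X - C (if j < k then y j else x j)) with hT
  have hμ : ∀ j, 0 ≤ μ j := gauss_weight_nonneg hx.injective (fun l => (hν l).le) (fun p hp => hmom p (by omega))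
  have hμ' : ∀ j, 0 ≤ μ' j := gauss_weight_nonneg hy.injective (fun l => mul_nonneg (hg l) (hν l).le) (fun p hp => hmom' p (by omega))
  have hA : 0 < ∑ l, ν l * (T.eval (w l)) ^ 2 := sum_mul_eval_sq_pos_of_natDegree_lt hν hw hTm.ne_zero (by omega)
  have hA' : 0 < ∑ l, (g l * ν l) * (T.eval (w l)) ^ 2 := sum_density_mul_sq_pos_of_card hν hw hg hS hgS hTm.ne_zero hTd.le
  have h1 := gaussNode_mul_sum_sq_le_of_eval_eq_zero_below hy hμ' hmom' hTd.le k hTy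
  have h2 := sum_node_sq_le_gaussNode_mul_of_eval_eq_zero_above hx hμ hmom hTd.le k hTx
  have h3 := rayleigh_num_mul_ge_of_antitone_density (fun l => (hν l).le) hgw T
  set A := ∑ l, ν l * (T.eval (w l)) ^ 2
  set B := ∑ l, ν l * (w l * (T.eval (w l)) ^ 2)
  set A' := ∑ l, (g l * ν l) * (T.eval (w l)) ^ 2
  set B' := ∑ l, (g l * ν l) * (w l * (T.eval (w l)) ^ 2)
  refine le_of_mul_le_mul_right ?_ (mul_pos hA hA')
  calc y k * (A * A') = (y k * A') * A := by ring
    _ ≤ B' * A := mul_le_mul_of_nonneg_right h1 hA.le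
    _ = A * B' := mul_comm _ _
    _ ≤ A' * B := h3
    _ ≤ A' * (x k * A) := mul_le_mul_of_nonneg_left h2 hA'.le
    _ = x k * (A * A') := by ring

/-- **TRUNCATION FROM THE RIGHT MOVES THE GAUSS NODES LEFT**: restricting `ν` to the atoms with `w_l ≤ c` (at least `t + 1` of them) gives a Gauss rule with `y_k ≤ x_k`. [this file, §1110] -/
theorem gauss_nodes_restrict_le {t N : ℕ} {ν w : Fin N → ℝ} (hν : ∀ l, 0 < ν l) (hw : Function.Injective w) (hN : t + 1 ≤ N) {c : ℝ}
    (hcard : t + 1 ≤ (Finset.univ.filter (fun l => w l ≤ c)).card)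
    {μ x μ' y : Fin (t + 1) → ℝ} (hx : StrictMono x) (hy : StrictMono y)
    (hmom : ∀ p, p ≤ 2 * t + 1 → ∑ j, μ j * x j ^ p = ∑ l, ν l * w l ^ p)
    (hmom' : ∀ p, p ≤ 2 * t + 1 → ∑ j, μ' j * y j ^ p = ∑ l, ((if w l ≤ c then 1 else 0) * ν l) * w l ^ p) (k : Fin (t + 1)) :
    y k ≤ x k :=
  markov_antitone_nonneg (g := fun l => if w l ≤ c then (1 : ℝ) else 0) hν hw hN (fun l => by positivity)
    (fun l l' h => by
      by_cases h' : w l' ≤ c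
      · rw [if_pos h', if_pos (h.le.trans h')]
      · rw [if_neg h']; positivity)
    hcard (fun l hl => by rw [if_pos (Finset.mem_filter.1 hl).2]; exact one_pos) hx hy hmom hmom' k

/-- **TRUNCATION FROM THE LEFT MOVES THE GAUSS NODES RIGHT**: restricting `ν` to the atoms with `c ≤ w_l` (at least `t + 1` of them) gives a Gauss rule with `x_k ≤ y_k`. [this file, §1110] -/
theorem gauss_nodes_restrict_ge {t N : ℕ} {ν w : Fin N → ℝ} (hν : ∀ l, 0 < ν l) (hw : Function.Injective w) (hN : t + 1 ≤ N) {c : ℝ}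
    (hcard : t + 1 ≤ (Finset.univ.filter (fun l => c ≤ w l)).card)
    {μ x μ' y : Fin (t + 1) → ℝ} (hx : StrictMono x) (hy : StrictMono y)
    (hmom : ∀ p, p ≤ 2 * t + 1 → ∑ j, μ j * x j ^ p = ∑ l, ν l * w l ^ p)
    (hmom' : ∀ p, p ≤ 2 * t + 1 → ∑ j, μ' j * y j ^ p = ∑ l, ((if c ≤ w l then 1 else 0) * ν l) * w l ^ p) (k : Fin (t + 1)) :
    x k ≤ y k :=
  markov_monotone_nonneg (g := fun l => if c ≤ w l then (1 : ℝ) else 0) hν hw hN (fun l => by positivity)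
    (fun l l' h => by
      by_cases h' : c ≤ w l
      · rw [if_pos h', if_pos (h'.trans h.le)]
      · rw [if_neg h']; positivity)
    hcard (fun l hl => by rw [if_pos (Finset.mem_filter.1 hl).2]; exact one_pos) hx hy hmom hmom' k

end Summit.Ventures.HSemireg.Wedge.HankelOuter
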